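import Literature.Probability.Process.BrownianVec
import Mathlib.Probability.Distributions.Gaussian.Real
import Mathlib.MeasureTheory.Measure.CharacteristicFunction.Basic
import Literature.MathematicalPhysics.QuantumFieldTheory.LatticeLangevinDynamics
import Mathlib.Analysis.Normed.Lp.MeasurableSpace
import HarnessLib

/-!
# Route `ColdStartUniversality` (fixed-cut-off package; brick «G1» of GAUGE COVARIANCE IN LAW of the SZZ dynamics, and of every
# reflection / rotation coupling of the driving noise): ORTHOGONAL IMAGES OF A BROWNIAN VECTOR, AND OF A FLAT LATTICE NOISE, ARE BROWNIAN

Helper file (seat `ym-line-csu-p1`, g10; `--supports stmt-QuantumFields-24809`).  For a `d`-dimensional Brownian motion `W`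
(`IsBrownianVec`: weak Markov property at deterministic times + Gaussian marginals `gaussVec d t = N(0, t I_d)`) and a real matrix `O`
with `Oᵀ O = 1`:

* `measure_ext_of_integral_cexp_sum` — two finite measures on `ℝᵈ = Fin d → ℝ` with the same `∫ exp(i Σ cᵢ xᵢ)` agree (Mathlib
  `Measure.ext_of_charFun` on the Hilbert space `PiLp 2`, as `PathLawOfIncrements.measure_ext_of_integral_cexp_re_conj` does for `ℂⁿ`);
* `gaussVec_map_mulVec` — ROTATION INVARIANCE of `N(0, t I_d)`: `(gaussVec d t).map (O *ᵥ ·) = gaussVec d t` (characteristic function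
  `exp(−t|Oᵀc|²/2) = exp(−t|c|²/2)`, as the tree's `integral_cexp_gaussVec`);
* `isBrownianVec_mulVec` — ★ `t ↦ O *ᵥ W_t` is again a `d`-dimensional Brownian motion for the same probability measure;
* `isFlatBrownian_orthogonal` — ★ the lattice form: for a flat noise `W : ℝ≥0 → Ω → (Edge d L × κ → ℝ)` (`IsFlatBrownian` = `IsBrownianVec`
  after enumerating the index set) and `R` with `Rᵀ R = 1` on the index set, `(t, ω, i) ↦ Σⱼ R i j · W t ω j` is flat (edgewise `Ad_h`
  rotations of the Lie-algebra coordinates under a lattice gauge transformation `h`, and reflections, are block-diagonal `R`).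

WHY (CSU lead memo g10, §3(c)): every currency of the K_A2 / TP lines is modulo gauge (`discG`, `wdisc`, `wd_K`), so any proof of
`ScalePropagation` / `OneWindowSwap` / `RegularPairOverlap` needs `law(V^{h·u}_t) = h·law(V^u_t)`, whose proof transforms the SZZ system
under `Q ↦ h Q h'⁻¹` into the same system driven by the ROTATED flat noise `Ad_h W` — this file supplies that the rotated noise is flat.
THEOREMS ONLY, [folklore] (Le Gall 2016, Ch. 2: invariance of Brownian motion under isometries); no crux or summit is proved; the
Yang–Mills mass gap is NOT proved.
-/

noncomputable section

open MeasureTheory ProbabilityTheory Filter Topology Complex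
open scoped NNReal ENNReal BigOperators

namespace Summit.QuantumFields.YangMills.Theorems.ColdStartUniversality.NoiseRotation

open Literature.Probability.Process Literature.MathematicalPhysics.QuantumFieldTheory

variable {d : ℕ}

/-- Private copy of the tree's `Literature.Probability.Process.integral_cexp_gaussVec` (its module `BrownianVecIncrementCharFun` is outside
the farm's build closure at the time of writing): `∫ exp(i c·x) dN(0, hI_d) = exp(−h|c|²/2)`. [folklore] -/
private theorem integral_cexp_gaussVec' (h : ℝ≥0) (c : Fin d → ℝ) :
    ∫ x, cexp (I * (∑ i, c i * x i : ℝ)) ∂gaussVec d h = cexp (-((h : ℝ) * (∑ i, c i ^ 2) / 2 : ℝ)) := by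
  have e1 : ∀ x : Fin d → ℝ, cexp (I * (∑ i, c i * x i : ℝ)) = ∏ i, cexp ((c i : ℂ) * (x i : ℂ) * I) := by
    intro x
    rw [← Complex.exp_sum]
    congr 1
    push_cast
    rw [Finset.mul_sum]
    refine Finset.sum_congr rfl fun i _ ↦ by ring
  simp_rw [e1]
  have hpi := integral_fintype_prod_eq_prod (𝕜 := ℂ) (f := fun i (x : ℝ) ↦ cexp ((c i : ℂ) * (x : ℂ) * I))
    (μ := fun _ : Fin d ↦ gaussianReal 0 h)
  rw [gaussVec, hpi]
  have e2 : ∀ i, ∫ x : ℝ, cexp ((c i : ℂ) * (x : ℂ) * I) ∂gaussianReal 0 h = cexp (-((h : ℝ) * c i ^ 2 / 2 : ℝ)) := by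
    intro i
    rw [← charFun_apply_real, charFun_gaussianReal]
    congr 1
    push_cast
    ring
  simp_rw [e2]
  rw [← Complex.exp_sum]
  congr 1
  push_cast
  rw [Finset.mul_sum, Finset.sum_div, ← Finset.sum_neg_distrib]


/-! ### Uniqueness on `ℝᵈ` from the characteristic function -/

/-- **Two finite measures on `ℝᵈ` with the same `∫ exp(i Σᵢ cᵢ xᵢ)` for all `c ∈ ℝᵈ` are equal.**
[cite: Billingsley1999, §26 (uniqueness for characteristic functions)] -/
theorem measure_ext_of_integral_cexp_sum {μ ν : Measure (Fin d → ℝ)} [IsFiniteMeasure μ] [IsFiniteMeasure ν]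
    (h : ∀ c : Fin d → ℝ, ∫ x, cexp (I * (∑ i, c i * x i : ℝ)) ∂μ = ∫ x, cexp (I * (∑ i, c i * x i : ℝ)) ∂ν) :
    μ = ν := by
  haveI : IsFiniteMeasure (μ.map (MeasurableEquiv.toLp 2 (Fin d → ℝ))) := Measure.isFiniteMeasure_map _ _
  haveI : IsFiniteMeasure (ν.map (MeasurableEquiv.toLp 2 (Fin d → ℝ))) := Measure.isFiniteMeasure_map _ _
  refine (MeasurableEquiv.toLp 2 (Fin d → ℝ)).map_measurableEquiv_injective
    (Measure.ext_of_charFun (funext fun t => ?_))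
  have key : ∀ x : Fin d → ℝ, inner ℝ ((MeasurableEquiv.toLp 2 (Fin d → ℝ)) x) t = ∑ i, t.ofLp i * x i := fun x => by
    rw [MeasurableEquiv.toLp_apply, PiLp.inner_apply]
    refine Finset.sum_congr rfl fun i _ => ?_
    rw [PiLp.toLp_apply]
    simp [mul_comm]
  rw [charFun_apply, charFun_apply, integral_map_equiv, integral_map_equiv]
  simp_rw [key]
  have e := h (fun i => t.ofLp i)
  simp_rw [mul_comm I] at e
  exact e

/-! ### Rotation invariance of `N(0, t I_d)` -/

/-- `Σᵢ cᵢ (O x)ᵢ = Σⱼ (Oᵀ c)ⱼ xⱼ`. [folklore] -/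
theorem sum_mul_mulVec (O : Matrix (Fin d) (Fin d) ℝ) (c x : Fin d → ℝ) :
    ∑ i, c i * (O.mulVec x) i = ∑ j, (O.transpose.mulVec c) j * x j := by
  have h1 : ∑ i, c i * (O.mulVec x) i = dotProduct c (O.mulVec x) := rfl
  have h2 : ∑ j, (O.transpose.mulVec c) j * x j = dotProduct (O.transpose.mulVec c) x := rfl
  rw [h1, h2, Matrix.dotProduct_mulVec, Matrix.mulVec_transpose]

/-- `|Oᵀ c|² = |c|²` when `Oᵀ O = 1`. [folklore] -/
theorem sum_sq_transpose_mulVec (O : Matrix (Fin d) (Fin d) ℝ) (hO : O.transpose * O = 1) (c : Fin d → ℝ) :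
    ∑ j, (O.transpose.mulVec c) j ^ 2 = ∑ i, c i ^ 2 := by
  have hO' : O * O.transpose = 1 := mul_eq_one_comm.mp hO
  have h1 : ∑ j, (O.transpose.mulVec c) j ^ 2 = dotProduct (O.transpose.mulVec c) (O.transpose.mulVec c) := by
    simp [dotProduct, sq]
  have h2 : ∑ i, c i ^ 2 = dotProduct c c := by simp [dotProduct, sq]
  rw [h1, h2]
  calc dotProduct (O.transpose.mulVec c) (O.transpose.mulVec c)
      = dotProduct (Matrix.vecMul c O) (O.transpose.mulVec c) := by rw [Matrix.mulVec_transpose]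
    _ = dotProduct c (O.mulVec (O.transpose.mulVec c)) := (Matrix.dotProduct_mulVec c O _).symm
    _ = dotProduct c c := by rw [Matrix.mulVec_mulVec, hO', Matrix.one_mulVec]

/-- The exponential observable `x ↦ exp(i Σ cᵢ xᵢ)` is measurable. [folklore] -/
theorem measurable_cexp_sum (c : Fin d → ℝ) :
    Measurable fun x : Fin d → ℝ => cexp (I * (∑ i, c i * x i : ℝ)) :=
  (measurable_const.mul (Complex.measurable_ofReal.comp
    (Finset.measurable_sum _ fun i _ => (measurable_pi_apply i).const_mul _))).cexp

/-- `x ↦ O x` is measurable. [folklore] -/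
theorem measurable_mulVec (O : Matrix (Fin d) (Fin d) ℝ) : Measurable fun x : Fin d → ℝ => O.mulVec x :=
  Continuous.measurable (by
    refine continuous_pi fun i => ?_
    simp only [Matrix.mulVec, dotProduct]
    exact continuous_finsetSum _ fun j _ => continuous_const.mul (continuous_apply j))

/-- ★ **Rotation invariance of the Gaussian vector `N(0, t I_d)`**: `(gaussVec d t).map (O *ᵥ ·) = gaussVec d t` for `Oᵀ O = 1`.
[cite: Legall2016, Ch. 1 (Gaussian vectors)] -/
theorem gaussVec_map_mulVec (t : ℝ≥0) (O : Matrix (Fin d) (Fin d) ℝ) (hO : O.transpose * O = 1) :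
    (gaussVec d t).map (fun x => O.mulVec x) = gaussVec d t := by
  haveI : IsFiniteMeasure ((gaussVec d t).map (fun x => O.mulVec x)) := Measure.isFiniteMeasure_map _ _
  refine measure_ext_of_integral_cexp_sum fun c => ?_
  rw [integral_map (measurable_mulVec O).aemeasurable (measurable_cexp_sum c).aestronglyMeasurable]
  have e : (fun x : Fin d → ℝ => cexp (I * (∑ i, c i * (O.mulVec x) i : ℝ))) =
      fun x => cexp (I * (∑ j, (O.transpose.mulVec c) j * x j : ℝ)) := by
    funext x
    rw [sum_mul_mulVec]
  rw [e, integral_cexp_gaussVec', integral_cexp_gaussVec', sum_sq_transpose_mulVec O hO]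

/-! ### Orthogonal images of a Brownian vector -/

section Vec

variable {Ω : Type*} {mΩ : MeasurableSpace Ω} {P : Measure Ω} {W : ℝ≥0 → Ω → (Fin d → ℝ)}

/-- The path map `p ↦ (u ↦ O (p u))` on path space is measurable. [folklore] -/
theorem measurable_pathMulVec {ι : Type*} (O : Matrix (Fin d) (Fin d) ℝ) :
    Measurable fun (p : ι → (Fin d → ℝ)) (u : ι) => O.mulVec (p u) :=
  measurable_pi_lambda _ fun u => (measurable_mulVec O).comp (measurable_pi_apply u)

/-- ★ **An orthogonal image of a `d`-dimensional Brownian motion is a `d`-dimensional Brownian motion**: if `W` is one and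
`Oᵀ O = 1`, so is `t ↦ O W_t` (same probability space; weak Markov property transported along the linear path map, Gaussian
marginals by `gaussVec_map_mulVec`). [cite: Legall2016, Ch. 2 (invariance properties of Brownian motion)] -/
theorem isBrownianVec_mulVec (hW : IsBrownianVec W P) (O : Matrix (Fin d) (Fin d) ℝ) (hO : O.transpose * O = 1) :
    IsBrownianVec (fun t ω => O.mulVec (W t ω)) P where
  measurable t := (measurable_mulVec O).comp (hW.measurable t)
  continuous_path ω := by
    refine continuous_pi fun i => ?_
    simp only [Matrix.mulVec, dotProduct]
    exact continuous_finsetSum _ fun j _ =>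
      continuous_const.mul ((continuous_apply j).comp (hW.continuous_path ω))
  apply_zero ω := by simp only [hW.apply_zero ω, Matrix.mulVec_zero]
  indep_shift s := by
    have hS : vecShift (fun t ω => O.mulVec (W t ω)) s =
        (fun (p : ℝ≥0 → (Fin d → ℝ)) (u : ℝ≥0) => O.mulVec (p u)) ∘ vecShift W s := by
      funext ω u
      simp only [vecShift, Function.comp, Matrix.mulVec_sub]
    have hPst : vecPast (fun t ω => O.mulVec (W t ω)) s =
        (fun (p : Set.Iic s → (Fin d → ℝ)) (r : Set.Iic s) => O.mulVec (p r)) ∘ vecPast W s := by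
      funext ω r
      simp only [vecPast, Function.comp]
    rw [hS, hPst]
    exact (hW.indep_shift s).comp (measurable_pathMulVec O) (measurable_pathMulVec O)
  map_shift s := by
    have hS : vecShift (fun t ω => O.mulVec (W t ω)) s =
        (fun (p : ℝ≥0 → (Fin d → ℝ)) (u : ℝ≥0) => O.mulVec (p u)) ∘ vecShift W s := by
      funext ω u
      simp only [vecShift, Function.comp, Matrix.mulVec_sub]
    have hPth : vecPath (fun t ω => O.mulVec (W t ω)) =
        (fun (p : ℝ≥0 → (Fin d → ℝ)) (u : ℝ≥0) => O.mulVec (p u)) ∘ vecPath W := by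
      funext ω u
      simp only [vecPath, Function.comp]
    rw [hS, hPth, ← Measure.map_map (measurable_pathMulVec O) (hW.measurable_vecShift s),
      ← Measure.map_map (measurable_pathMulVec O) hW.measurable_vecPath, hW.map_shift s]
  map_apply t := by
    have h : (fun ω => O.mulVec (W t ω)) = (fun x => O.mulVec x) ∘ W t := rfl
    rw [h, ← Measure.map_map (measurable_mulVec O) (hW.measurable t), hW.map_apply t, gaussVec_map_mulVec t O hO]


end Vec

/-! ### The lattice form: orthogonal transformations of a flat Brownian noise -/

section Lattice

variable {L : ℕ} [NeZero L] {κ : Type*} [Fintype κ] [DecidableEq κ] {Ω : Type*} {mΩ : MeasurableSpace Ω}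
  {P : Measure Ω}

/-- ★ **An orthogonal transformation of a flat Brownian noise is a flat Brownian noise**: for `W` flat (independent standard
Brownian motions indexed by `Edge d L × κ`) and a real matrix `R` over that index set with `Rᵀ R = 1`, the noise
`(t, ω, i) ↦ Σⱼ R i j · W t ω j` is flat (edgewise rotations and reflections of the Lie-algebra coordinates are the case of
block-diagonal `R`). [cite: Legall2016, Ch. 2 (invariance properties of Brownian motion)] -/
theorem isFlatBrownian_orthogonal {W : ℝ≥0 → Ω → (Edge d L × κ → ℝ)} (hW : IsFlatBrownian W P)
    (R : Matrix (Edge d L × κ) (Edge d L × κ) ℝ) (hR : R.transpose * R = 1) :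
    IsFlatBrownian (fun t ω i => ∑ j, R i j * W t ω j) P := by
  classical
  unfold IsFlatBrownian at hW ⊢
  set e := Fintype.equivFin (Edge d L × κ) with he
  -- the reindexed matrix on `Fin n`
  set O : Matrix (Fin (Fintype.card (Edge d L × κ))) (Fin (Fintype.card (Edge d L × κ))) ℝ :=
    Matrix.reindex e e R with hOdef
  have hO : O.transpose * O = 1 := by
    rw [hOdef, Matrix.reindex_apply, Matrix.transpose_submatrix, Matrix.submatrix_mul_equiv, hR,
      Matrix.submatrix_one_equiv]
  have hfun : (fun t ω (k : Fin (Fintype.card (Edge d L × κ))) => ∑ j, R (e.symm k) j * W t ω j) =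
      fun t ω => O.mulVec (fun k => W t ω (e.symm k)) := by
    funext t ω k
    simp only [hOdef, Matrix.mulVec, dotProduct, Matrix.reindex_apply, Matrix.submatrix_apply]
    exact (Equiv.sum_comp e.symm (fun j => R (e.symm k) j * W t ω j)).symm
  rw [hfun]
  exact isBrownianVec_mulVec hW O hO

end Lattice

end Summit.QuantumFields.YangMills.Theorems.ColdStartUniversality.NoiseRotation

end
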